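import Literature.NumberTheory.EllipticCurves.ModPIrreducibleCongruenceTransferProofs
import Literature.NumberTheory.EllipticCurves.SwanConductorTorsionProofs
import Literature.NumberTheory.GaloisRepresentations.ResidualGaloisRep
import HarnessLib

/-!
# Mod-`p` Galois representations of elliptic curves with congruent Frobenius traces are isomorphic
# (irreducible case) — proofs

Topic `NumberTheory/EllipticCurves` (trunk T-ELLARITH); a `Proofs` file (theorems only, nothing is
defined, no named fact) continuing `ModPReducibilityAlmostAllProofs` (rational `p`-torsion /
reducibility along a congruence) and `ModPIrreducibleCongruenceTransferProofs` (irreducibility along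
a congruence) on the mod-`p` Galois representation `ρ̄_{E,p} : Γ_ℚ → Aut(E[p])`
(`WeierstrassCurve.galoisRepTorsion`, its `𝔽_p`-linear form `WeierstrassCurve.galoisRepTorsionLin`,
`WeierstrassCurve.HasIrreducibleModPGaloisRep`) and the traces of Frobenius `a_ℓ(E)`
(`WeierstrassCurve.frobeniusTrace`).

Darmon–Diamond–Taylor, *Fermat's Last Theorem* (1995) [held copy
`paper:doi-10-4310-cdm-1995-v1995-n1-a1`]: Thm. 2.3 (PDF p. 52 L6–L7, Chebotarev: "If `F/ℚ` is a
Galois extension unramified outside a finite set `S` of primes then `∪_{p ∉ S} [Frob_p]` is dense in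
`Gal(F/ℚ)`"), Prop. 2.6 (b) (PDF p. 53 L25–L33: "Let `S` be any finite set of primes. … A
semi-simple mod `ℓ` representation `ρ : G_ℚ → GL_d(k)` is determined by the values of
`tr ∧^i ρ(Frob_p)` (`i = 1, …, d`) on the primes `p ∉ S` at which `ρ` is unramified" — by
Chebotarev and the Brauer–Nesbitt theorem), Prop. 2.8 (a) (PDF p. 56: "`det ρ_{E,ℓ} = ε`"),
Prop. 2.11 (a) (PDF p. 57 L1–L5: "Suppose `E` has good reduction at `p`. (a) If `ℓ ≠ p`, then
`ρ_{E,ℓ}` is unramified at `p`, and … `tr ρ_{E,ℓ}(Frob_p) = p + 1 − #Ē_p(𝔽_p)`").  For `d = 2` the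
two invariants are `tr` and `det`, so for two elliptic curves `W, G / ℚ` with
`a_ℓ(W) ≡ a_ℓ(G) (mod p)` at the good primes `ℓ` off a finite set the semisimplifications of
`ρ̄_{W,p}` and `ρ̄_{G,p}` agree; **if `W[p]` is irreducible then `G[p] ≅ W[p]` as
`𝔽_p[Γ_ℚ]`-modules** — the statement proved here.  This is the form in which the congruence nodes
of the cell `b2b-bsdres` use it ("so `ρ̄_G^{ss} ≅ ρ̄_W^{ss}` by Brauer–Nesbitt–Chebotarev, and
`ρ̄_G ≅ ρ̄_W` when `ρ̄_W` is irreducible", `Summits/…/Rank1Residual/O5/O5CompanionTransport.lean`;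
the labelled binder `hBNC` of `O5/CompanionTypeLawThreeOfModThreeTransport.lean`).

## The proof formalised

Both `W[p]` and `G[p]` are irreducible (`hasIrreducibleModPGaloisRep_of_frobeniusTrace_congr_off_finite`,
the previous file), hence semisimple `𝔽_p[Γ_ℚ]`-modules.  For `σ ∈ Γ_ℚ` choose, by Chebotarev for
`ℚ(W[p], G[p])` (`exists_frobenius_smul_eq_pair`, from the tree's proved
`GaloisRepresentations.chebotarevArtinRep_holds`), an arithmetic Frobenius `φ` above a prime
`ℓ ∉ S ∪ {ℓ ≤ max(p, |Δ_W|, |Δ_G|)}` acting as `σ` on both modules.  On the `𝔽_p`-planes `W[p]`,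
`G[p]` the endomorphisms `ρ̄_W(σ) = ρ̄_W(φ)`, `ρ̄_G(σ) = ρ̄_G(φ)` have traces `a_ℓ(W)`, `a_ℓ(G) mod p`
(`trace_galoisRepTorsion_frobenius_eq`, DDT 2.11 (a)) — equal by the congruence — and determinant
`ℓ mod p` (`det_galoisRepTorsion_frobenius_eq`, DDT 2.8 (a)), hence the same characteristic
polynomial `X² − tr·X + det`.  The Brauer–Nesbitt theorem over `𝔽_p` (the tree's PROVED
`GaloisRepresentations.brauerNesbitt_holds`, Bourbaki *Algèbre* VIII §20 n°6 Cor. 1, any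
characteristic) gives an isomorphism of representations `ρ̄_G ≅ ρ̄_W`.

* §1 `WeierstrassCurve.isIrreducible_galoisRepTorsionLin_of_hasIrreducibleModPGaloisRep` (any field:
  the tree's `HasIrreducibleModPGaloisRep` is Mathlib's `Representation.IsIrreducible` of
  `galoisRepTorsionLin`, given `E[p] ≠ 0`), and the converse;
* §2 `charpoly_galoisRepTorsionLin_eq_of_frobeniusTrace_congr_off_finite` (equal characteristic
  polynomials for every `σ ∈ Γ_ℚ`; no irreducibility needed);
* §3 `nonempty_equiv_galoisRepTorsionLin_of_frobeniusTrace_congr_off_finite` (Mathlib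
  `Representation.Equiv`) and the additive spelling
  `exists_addEquiv_geomTorsion_of_frobeniusTrace_congr_off_finite`
  (`∃ e : G[p] ≃+ W[p], ∀ σ P, e (σ • P) = σ • e P`), plus the symmetric direction.

## References

* H. Darmon, F. Diamond, R. Taylor, *Fermat's Last Theorem*, Current Developments in Mathematics
  1995, International Press, 1–154: Thm. 2.3, Prop. 2.6 (b), Prop. 2.8 (a), Prop. 2.11 (a)
  (PDF pp. 52–57). [DarmonDiamondTaylor1995]
* N. Bourbaki, *Algèbre*, Ch. VIII (2012), §20 n°6, Thm. 2, Cor. 1 (p. 378) (Brauer–Nesbitt).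
  [BourbakiAlgebreVIII2012]
* J.-P. Serre, *Propriétés galoisiennes des points d'ordre fini des courbes elliptiques*, Invent.
  Math. 15 (1972), §4. [SerreInventiones1972]
* J. H. Silverman, *The Arithmetic of Elliptic Curves*, 2nd ed. (2009), III.§7. [SilvermanAEC2009]

## Design

Theorems only; no `def`, no named fact, no new vocabulary; the `ZMod p`-module structure on `E[p]`
is Mathlib's `AddSubgroup.torsionBy.zmodModule`, introduced by `letI` in each statement (the
convention of `SupersingularDensitySerreTraceProofs` / `ModPIrreducibleCongruenceTransferProofs`; it is
the instance under which `galoisRepTorsionLin` is defined in `SwanConductorTorsionProofs`).  Axioms of every theorem: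
`propext`, `Classical.choice`, `Quot.sound`.  Cell `b2b-bsdres`, harvest seat 2, GEN 54, E109.
-/

noncomputable section

open scoped Classical NumberField
open IsDedekindDomain Field Polynomial

universe u

namespace WeierstrassCurve

open Literature.NumberTheory.EllipticCurves Literature.NumberTheory.GaloisRepresentations

/-! ### §1 `HasIrreducibleModPGaloisRep` is irreducibility of `galoisRepTorsionLin` -/

section AnyField

variable {F : Type u} [Field F] (W : WeierstrassCurve F) (p : ℕ) [Fact p.Prime]

/-- **`E[p]` irreducible in the tree's sense ⇒ `ρ̄_{E,p}` irreducible in Mathlib's sense.**  If the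
only `Γ_F`-stable subgroups of `E[p]` are `0` and `E[p]` (`W.HasIrreducibleModPGaloisRep p`) and
`E[p] ≠ 0`, then the `𝔽_p`-linear representation `W.galoisRepTorsionLin p` of `Γ_F` on `E[p]` is
irreducible (Mathlib `Representation.IsIrreducible`: the lattice of subrepresentations is simple):
a subrepresentation is in particular a `Γ_F`-stable subgroup.  (Darmon–Diamond–Taylor 1995,
§2.2: "`E[n](ℚ̄)` carries a natural action of `G_ℚ` and so we get a representation
`ρ̄_{E,n} : G_ℚ → GL₂(ℤ/nℤ)`"; Silverman *AEC* III.§7; Serre 1972, §4.)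
[cite: DarmonDiamondTaylor1995, §2.2 (ρ̄_{E,n} : G_ℚ → GL₂(ℤ/nℤ), PDF p. 55) and Prop. 2.6 (b) (PDF p. 53)]
[cite: SilvermanAEC2009, III.§7 (the representation on E[m])] -/
theorem isIrreducible_galoisRepTorsionLin_of_hasIrreducibleModPGaloisRep
    [Nontrivial (geomTorsion W p)] (hirr : W.HasIrreducibleModPGaloisRep p) :
    letI : Module (ZMod p) (geomTorsion W p) := AddSubgroup.torsionBy.zmodModule
    (W.galoisRepTorsionLin p).IsIrreducible := by
  letI : Module (ZMod p) (geomTorsion W p) := AddSubgroup.torsionBy.zmodModule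
  have hbt : (⊥ : Subrepresentation (W.galoisRepTorsionLin p)) ≠ ⊤ := by
    intro h
    have h' : (⊥ : Submodule (ZMod p) (geomTorsion W p)) = ⊤ :=
      congrArg Subrepresentation.toSubmodule h
    exact bot_ne_top h'
  refine { toNontrivial := ⟨⟨⊥, ⊤, hbt⟩⟩, eq_bot_or_eq_top := fun V ↦ ?_ }
  have hV : ∀ σ : absoluteGaloisGroup F, ∀ Q ∈ V.toSubmodule.toAddSubgroup,
      σ • Q ∈ V.toSubmodule.toAddSubgroup := fun σ Q hQ ↦ V.apply_mem_toSubmodule σ hQ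
  rcases hirr V.toSubmodule.toAddSubgroup hV with h0 | h1
  · left
    apply Subrepresentation.toSubmodule_injective
    change V.toSubmodule = ⊥
    rw [← Submodule.toAddSubgroup_inj, h0, Submodule.bot_toAddSubgroup]
  · right
    apply Subrepresentation.toSubmodule_injective
    change V.toSubmodule = ⊤
    exact Submodule.toAddSubgroup_eq_top.mp h1

/-- Conversely, **`ρ̄_{E,p}` irreducible in Mathlib's sense ⇒ `E[p]` irreducible in the tree's
sense**: every `Γ_F`-stable subgroup of the `𝔽_p`-space `E[p]` is an `𝔽_p`-subspace (scalars act
through `ℕ`), hence a subrepresentation. (Darmon–Diamond–Taylor 1995, §2.2; Serre 1972, §4.)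
[cite: DarmonDiamondTaylor1995, §2.2 (ρ̄_{E,n} : G_ℚ → GL₂(ℤ/nℤ), PDF p. 55) and Prop. 2.6 (b) (PDF p. 53)]
[cite: SilvermanAEC2009, III.§7 (the representation on E[m])] -/
theorem hasIrreducibleModPGaloisRep_of_isIrreducible_galoisRepTorsionLin
    (hirr : letI : Module (ZMod p) (geomTorsion W p) := AddSubgroup.torsionBy.zmodModule
      (W.galoisRepTorsionLin p).IsIrreducible) : W.HasIrreducibleModPGaloisRep p := by
  letI : Module (ZMod p) (geomTorsion W p) := AddSubgroup.torsionBy.zmodModule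
  intro H hH
  -- `H` as a subrepresentation
  let V : Subrepresentation (W.galoisRepTorsionLin p) :=
    { toSubmodule := (AddSubgroup.toZModSubmodule p) H
      apply_mem_toSubmodule := fun σ Q hQ ↦ hH σ Q hQ }
  have hVH : V.toSubmodule.toAddSubgroup = H := AddSubgroup.toZModSubmodule_toAddSubgroup p H
  rcases hirr.eq_bot_or_eq_top V with h | h
  · left
    rw [← hVH, show V.toSubmodule = ⊥ from congrArg Subrepresentation.toSubmodule h,
      Submodule.bot_toAddSubgroup]
  · right
    rw [← hVH, show V.toSubmodule = ⊤ from congrArg Subrepresentation.toSubmodule h,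
      Submodule.top_toAddSubgroup]

end AnyField

end WeierstrassCurve

namespace Literature.NumberTheory.EllipticCurves

open _root_.WeierstrassCurve _root_.NumberField Literature.NumberTheory.GaloisRepresentations

/-! ### §2 Equal characteristic polynomials on `W[p]` and `G[p]` along a congruence of traces -/

section Plane

variable {k : Type*} [Field k] {V : Type*} [AddCommGroup V] [Module k V] [FiniteDimensional k V]

/-- On a `2`-dimensional space the characteristic polynomial of an endomorphism `f` is
`X² − tr(f) X + det(f)` (Mathlib `Matrix.charpoly_fin_two` in a basis). [folklore] -/
private theorem charpoly_eq_of_finrank_eq_two (h2 : Module.finrank k V = 2) (f : Module.End k V) :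
    f.charpoly = X ^ 2 - C (LinearMap.trace k V f) * X + C (LinearMap.det f) := by
  let b := Module.finBasisOfFinrankEq k V h2
  rw [← LinearMap.charpoly_toMatrix f b, Matrix.charpoly_fin_two,
    ← LinearMap.trace_eq_matrix_trace k b f, LinearMap.det_toMatrix b f]

end Plane

section Main

variable (W G : WeierstrassCurve ℚ) [W.IsElliptic] [W.IsGloballyMinimal] [G.IsElliptic]
  [G.IsGloballyMinimal] (p : ℕ) [Fact p.Prime]

omit [W.IsGloballyMinimal] in
/-- `E[p]` is finite for an elliptic `E/ℚ` (Silverman *AEC* Cor. III.6.4; the tree's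
`finite_torsionPoints_holds`). [cite: SilvermanAEC2009, Cor. III.6.4] -/
private theorem finite_geomTorsion_prime : Finite (W.geomTorsion p) :=
  finite_torsionPoints_holds W (AlgebraicClosure ℚ) (n := p)
    (by exact_mod_cast (Fact.out : p.Prime).ne_zero)

omit [W.IsGloballyMinimal] in
/-- `dim_{𝔽_p} E[p] = 2` for an elliptic `E/ℚ` (`#E[p] = p²`, Silverman *AEC* Cor. III.6.4 (b); the
tree's `card_torsionPoints_eq_sq_holds` and `finrank_eq_two_of_natCard_eq_sq`).
[cite: SilvermanAEC2009, Cor. III.6.4(b)] -/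
private theorem finrank_geomTorsion_prime_eq_two :
    letI : Module (ZMod p) (W.geomTorsion p) := AddSubgroup.torsionBy.zmodModule
    Module.finrank (ZMod p) (W.geomTorsion p) = 2 :=
  letI : Module (ZMod p) (W.geomTorsion p) := AddSubgroup.torsionBy.zmodModule
  Literature.RepresentationTheory.FiniteGroups.Representation.finrank_eq_two_of_natCard_eq_sq
    (card_torsionPoints_eq_sq_holds W (AlgebraicClosure ℚ) (n := p)
      (by exact_mod_cast (Fact.out : p.Prime).ne_zero))

omit [W.IsGloballyMinimal] in
/-- `E[p] ≠ 0` for an elliptic `E/ℚ` (`#E[p] = p² > 1`). [cite: SilvermanAEC2009, Cor. III.6.4(b)] -/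
private theorem nontrivial_geomTorsion_prime : Nontrivial (W.geomTorsion p) := by
  have hp : p.Prime := Fact.out
  haveI : Finite (W.geomTorsion p) := finite_geomTorsion_prime W p
  have hcard : Nat.card (W.geomTorsion p) = p ^ 2 :=
    card_torsionPoints_eq_sq_holds W (AlgebraicClosure ℚ) (n := p) (by exact_mod_cast hp.ne_zero)
  rw [← Finite.one_lt_card_iff_nontrivial, hcard]
  exact Nat.one_lt_pow two_ne_zero hp.one_lt

/-- **Equal characteristic polynomials of `ρ̄_{W,p}(σ)` and `ρ̄_{G,p}(σ)` for every `σ ∈ Γ_ℚ`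
along a mod-`p` congruence of traces off a finite set** (Darmon–Diamond–Taylor 1995, the datum of
Prop. 2.6 (b) for `d = 2`, with Prop. 2.8 (a), Prop. 2.11 (a) and Thm. 2.3).  Let `W, G / ℚ` be
elliptic curves in global minimal form, `p` a prime, `S ⊆ ℕ` finite, with
`p ∣ a_ℓ(W) − a_ℓ(G)` at every prime `ℓ ∉ S` of good reduction for both.  Then for every
`σ ∈ Γ_ℚ` the `𝔽_p`-linear endomorphisms `ρ̄_{G,p}(σ)` of `G[p]` and `ρ̄_{W,p}(σ)` of `W[p]` have
the same characteristic polynomial: by Chebotarev for `ℚ(W[p], G[p])` `σ` acts on both modules as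
an arithmetic Frobenius `φ` above a good `ℓ ∉ S ∪ {p}`, whose trace is `a_ℓ mod p` (2.11 (a)) and
determinant `ℓ mod p` (2.8 (a)) on either plane.
[cite: DarmonDiamondTaylor1995, Prop. 2.6 (b), Prop. 2.8 (a), Prop. 2.11 (a), Thm. 2.3 (PDF pp. 52–57)] -/
theorem charpoly_galoisRepTorsionLin_eq_of_frobeniusTrace_congr_off_finite (S : Set ℕ)
    (hS : S.Finite)
    (hcong : ∀ (ℓ : ℕ) [Fact ℓ.Prime], ℓ ∉ S → W.HasGoodReductionAtPrime ℓ →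
      G.HasGoodReductionAtPrime ℓ → (p : ℤ) ∣ W.frobeniusTrace ℓ - G.frobeniusTrace ℓ)
    (σ : absoluteGaloisGroup ℚ) :
    letI : Module (ZMod p) (W.geomTorsion p) := AddSubgroup.torsionBy.zmodModule
    letI : Module (ZMod p) (G.geomTorsion p) := AddSubgroup.torsionBy.zmodModule
    haveI := finite_geomTorsion_prime W p
    haveI := finite_geomTorsion_prime G p
    haveI : Module.Finite (ZMod p) (W.geomTorsion p) := Module.Finite.of_finite
    haveI : Module.Finite (ZMod p) (G.geomTorsion p) := Module.Finite.of_finite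
    (G.galoisRepTorsionLin p σ).charpoly = (W.galoisRepTorsionLin p σ).charpoly := by
  letI : Module (ZMod p) (W.geomTorsion p) := AddSubgroup.torsionBy.zmodModule
  letI : Module (ZMod p) (G.geomTorsion p) := AddSubgroup.torsionBy.zmodModule
  haveI := finite_geomTorsion_prime W p
  haveI := finite_geomTorsion_prime G p
  haveI : Module.Finite (ZMod p) (W.geomTorsion p) := Module.Finite.of_finite
  haveI : Module.Finite (ZMod p) (G.geomTorsion p) := Module.Finite.of_finite
  have hp : p.Prime := Fact.out
  have h2G : Module.finrank (ZMod p) (G.geomTorsion p) = 2 := finrank_geomTorsion_prime_eq_two G p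
  have h2W : Module.finrank (ZMod p) (W.geomTorsion p) = 2 := finrank_geomTorsion_prime_eq_two W p
  -- a Frobenius above a large good prime `ℓ ∉ S ∪ {p}` acting as `σ` on both modules
  have hΔW : minimalDiscriminantInt W ≠ 0 := minimalDiscriminantInt_ne_zero W
  have hΔG : minimalDiscriminantInt G ≠ 0 := minimalDiscriminantInt_ne_zero G
  let S' : Set ℕ := S ∪ {ℓ | ℓ ≤ max p (max (minimalDiscriminantInt W).natAbs
    (minimalDiscriminantInt G).natAbs)}
  have hS' : S'.Finite := hS.union (Set.finite_le_nat _)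
  obtain ⟨ℓ, v, 𝔓, φ, hℓ, hℓS', hℓv, h𝔓, hφ, hWφ, hGφ⟩ :=
    exists_frobenius_smul_eq_pair W G (n := p) (by exact_mod_cast hp.ne_zero) S' hS' σ
  haveI : Fact ℓ.Prime := ⟨hℓ⟩
  have hℓS : ℓ ∉ S := fun h ↦ hℓS' (Or.inl h)
  have hℓgt : max p (max (minimalDiscriminantInt W).natAbs (minimalDiscriminantInt G).natAbs) < ℓ :=
    not_le.mp fun h ↦ hℓS' (Or.inr h)
  have hℓp : ℓ ≠ p := by
    have := le_max_left p (max (minimalDiscriminantInt W).natAbs (minimalDiscriminantInt G).natAbs)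
    omega
  have hℓΔW : ¬ (ℓ : ℤ) ∣ minimalDiscriminantInt W := fun h ↦ by
    have h1 := Nat.le_of_dvd (Int.natAbs_pos.mpr hΔW) (Int.natCast_dvd.mp h)
    have h2 : (minimalDiscriminantInt W).natAbs ≤
        max p (max (minimalDiscriminantInt W).natAbs (minimalDiscriminantInt G).natAbs) :=
      (le_max_left _ _).trans (le_max_right _ _)
    omega
  have hℓΔG : ¬ (ℓ : ℤ) ∣ minimalDiscriminantInt G := fun h ↦ by
    have h1 := Nat.le_of_dvd (Int.natAbs_pos.mpr hΔG) (Int.natCast_dvd.mp h)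
    have h2 : (minimalDiscriminantInt G).natAbs ≤
        max p (max (minimalDiscriminantInt W).natAbs (minimalDiscriminantInt G).natAbs) :=
      (le_max_right _ _).trans (le_max_right _ _)
    omega
  have hgoodW : W.HasGoodReductionAtPrime ℓ := hasGoodReductionAtPrime_of_not_dvd W ℓ hℓΔW
  have hgoodG : G.HasGoodReductionAtPrime ℓ := hasGoodReductionAtPrime_of_not_dvd G ℓ hℓΔG
  have hvℓ : (Rat.HeightOneSpectrum.primesEquiv v : ℕ) = ℓ := primesEquiv_eq_of_natCast_mem hℓ hℓv
  -- `ρ̄(σ) = ρ̄(φ)` on both modules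
  have eW : W.galoisRepTorsionLin p σ = W.galoisRepTorsionLin p φ :=
    LinearMap.ext fun P ↦ by rw [galoisRepTorsionLin_apply, galoisRepTorsionLin_apply, hWφ P]
  have eG : G.galoisRepTorsionLin p σ = G.galoisRepTorsionLin p φ :=
    LinearMap.ext fun P ↦ by rw [galoisRepTorsionLin_apply, galoisRepTorsionLin_apply, hGφ P]
  -- the Frobenius endomorphisms of the trace / determinant lemmas are these linear maps
  have hfW : (galoisRepTorsion W p φ).toAdd.toAddMonoidHom.toZModLinearMap p =
      W.galoisRepTorsionLin p φ := LinearMap.ext fun _ ↦ rfl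
  have hfG : (galoisRepTorsion G p φ).toAdd.toAddMonoidHom.toZModLinearMap p =
      G.galoisRepTorsionLin p φ := LinearMap.ext fun _ ↦ rfl
  -- equal traces (`a_ℓ(W) ≡ a_ℓ(G)`) and determinants (`ℓ`)
  have htrW := W.trace_galoisRepTorsion_frobenius_eq p hℓp hgoodW hvℓ h𝔓 hφ
  have htrG := G.trace_galoisRepTorsion_frobenius_eq p hℓp hgoodG hvℓ h𝔓 hφ
  have hdetW := W.det_galoisRepTorsion_frobenius_eq p hℓp hgoodW hvℓ h𝔓 hφ
  have hdetG := G.det_galoisRepTorsion_frobenius_eq p hℓp hgoodG hvℓ h𝔓 hφ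
  rw [hfW] at htrW hdetW
  rw [hfG] at htrG hdetG
  have hcongr : ((G.frobeniusTrace ℓ : ℤ) : ZMod p) = ((W.frobeniusTrace ℓ : ℤ) : ZMod p) :=
    (ZMod.intCast_eq_intCast_iff_dvd_sub _ _ p).mpr (hcong ℓ hℓS hgoodW hgoodG)
  rw [eW, eG, charpoly_eq_of_finrank_eq_two h2G, charpoly_eq_of_finrank_eq_two h2W, htrW, htrG,
    hdetW, hdetG, hcongr]

/-! ### §3 The isomorphism `G[p] ≅ W[p]` (Brauer–Nesbitt) -/

/-- **Mod-`p` representations with congruent traces are isomorphic when one is irreducible**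
(Darmon–Diamond–Taylor 1995, Prop. 2.6 (b) with Prop. 2.8 (a), Prop. 2.11 (a): "a semi-simple
mod `ℓ` representation `ρ : G_ℚ → GL_d(k)` is determined by the values of `tr ∧^i ρ(Frob_p)`
(`i = 1, …, d`) on the primes `p ∉ S` at which `ρ` is unramified").  Let `W, G / ℚ` be elliptic
curves in global minimal form, `p` a prime, `S ⊆ ℕ` finite, with `p ∣ a_ℓ(W) − a_ℓ(G)` at every
prime `ℓ ∉ S` of good reduction for both, and suppose `W[p]` is an irreducible `Γ_ℚ`-module.  Then
the `𝔽_p[Γ_ℚ]`-modules `G[p]` and `W[p]` are isomorphic (Mathlib `Representation.Equiv` of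
`galoisRepTorsionLin`).  Proof: `G[p]` is irreducible too
(`hasIrreducibleModPGaloisRep_of_frobeniusTrace_congr_off_finite`), both are semisimple, the
characteristic polynomials agree for every `σ` (§2), and the Brauer–Nesbitt theorem over `𝔽_p`
(`GaloisRepresentations.brauerNesbitt_holds`, Bourbaki *Algèbre* VIII §20 n°6 Cor. 1) applies.
[cite: DarmonDiamondTaylor1995, Prop. 2.6 (b), Prop. 2.8 (a), Prop. 2.11 (a) (PDF pp. 53–57)]
[cite: BourbakiAlgebreVIII2012, VIII § 20 n° 6, Thm. 2, Cor. 1 (p. 378)] -/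
theorem nonempty_equiv_galoisRepTorsionLin_of_frobeniusTrace_congr_off_finite
    (hirr : W.HasIrreducibleModPGaloisRep p) (S : Set ℕ) (hS : S.Finite)
    (hcong : ∀ (ℓ : ℕ) [Fact ℓ.Prime], ℓ ∉ S → W.HasGoodReductionAtPrime ℓ →
      G.HasGoodReductionAtPrime ℓ → (p : ℤ) ∣ W.frobeniusTrace ℓ - G.frobeniusTrace ℓ) :
    letI : Module (ZMod p) (W.geomTorsion p) := AddSubgroup.torsionBy.zmodModule
    letI : Module (ZMod p) (G.geomTorsion p) := AddSubgroup.torsionBy.zmodModule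
    Nonempty ((G.galoisRepTorsionLin p).Equiv (W.galoisRepTorsionLin p)) := by
  letI : Module (ZMod p) (W.geomTorsion p) := AddSubgroup.torsionBy.zmodModule
  letI : Module (ZMod p) (G.geomTorsion p) := AddSubgroup.torsionBy.zmodModule
  haveI := finite_geomTorsion_prime W p
  haveI := finite_geomTorsion_prime G p
  haveI : Module.Finite (ZMod p) (W.geomTorsion p) := Module.Finite.of_finite
  haveI : Module.Finite (ZMod p) (G.geomTorsion p) := Module.Finite.of_finite
  haveI := nontrivial_geomTorsion_prime W p
  haveI := nontrivial_geomTorsion_prime G p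
  have hirrG : G.HasIrreducibleModPGaloisRep p :=
    hasIrreducibleModPGaloisRep_of_frobeniusTrace_congr_off_finite W G p hirr S hS hcong
  haveI hIW : (W.galoisRepTorsionLin p).IsIrreducible :=
    W.isIrreducible_galoisRepTorsionLin_of_hasIrreducibleModPGaloisRep p hirr
  haveI hIG : (G.galoisRepTorsionLin p).IsIrreducible :=
    G.isIrreducible_galoisRepTorsionLin_of_hasIrreducibleModPGaloisRep p hirrG
  have hssW : (W.galoisRepTorsionLin p).IsSemisimpleRepresentation := inferInstance
  have hssG : (G.galoisRepTorsionLin p).IsSemisimpleRepresentation := inferInstance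
  exact brauerNesbitt_holds (G.galoisRepTorsionLin p) (W.galoisRepTorsionLin p) hssG hssW
    (charpoly_galoisRepTorsionLin_eq_of_frobeniusTrace_congr_off_finite W G p S hS hcong)

/-- **Additive spelling**: under the hypotheses of
`nonempty_equiv_galoisRepTorsionLin_of_frobeniusTrace_congr_off_finite` there is a
`Γ_ℚ`-equivariant additive isomorphism `e : G[p] ≃+ W[p]`, `e (σ • P) = σ • e P` — the shape of the
binders of the cell `b2b-bsdres` (`O5/CompanionTypeLawThreeOfModThreeTransport.lean`, `hBNC`) and
of the conclusion of the Kraus–Oesterlé fact `KrausOesterle1992.prop4_torsionIso_of_congruences`.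
[cite: DarmonDiamondTaylor1995, Prop. 2.6 (b), Prop. 2.8 (a), Prop. 2.11 (a) (PDF pp. 53–57)] -/
theorem exists_addEquiv_geomTorsion_of_frobeniusTrace_congr_off_finite
    (hirr : W.HasIrreducibleModPGaloisRep p) (S : Set ℕ) (hS : S.Finite)
    (hcong : ∀ (ℓ : ℕ) [Fact ℓ.Prime], ℓ ∉ S → W.HasGoodReductionAtPrime ℓ →
      G.HasGoodReductionAtPrime ℓ → (p : ℤ) ∣ W.frobeniusTrace ℓ - G.frobeniusTrace ℓ) :
    ∃ e : G.geomTorsion p ≃+ W.geomTorsion p,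
      ∀ (σ : absoluteGaloisGroup ℚ) (P : G.geomTorsion p), e (σ • P) = σ • e P := by
  letI : Module (ZMod p) (W.geomTorsion p) := AddSubgroup.torsionBy.zmodModule
  letI : Module (ZMod p) (G.geomTorsion p) := AddSubgroup.torsionBy.zmodModule
  obtain ⟨e⟩ :=
    nonempty_equiv_galoisRepTorsionLin_of_frobeniusTrace_congr_off_finite W G p hirr S hS hcong
  refine ⟨e.toLinearEquiv.toAddEquiv, fun σ P ↦ ?_⟩
  have h := Representation.IntertwiningMap.isIntertwining _ _ e.toIntertwiningMap σ P
  rw [galoisRepTorsionLin_apply, galoisRepTorsionLin_apply,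
    Representation.Equiv.coe_toIntertwiningMap] at h
  exact h

/-- Symmetric direction: an equivariant `W[p] ≃+ G[p]` (inverse of the previous isomorphism).
[cite: DarmonDiamondTaylor1995, Prop. 2.6 (b) (PDF p. 53)] -/
theorem exists_addEquiv_geomTorsion_of_frobeniusTrace_congr_off_finite'
    (hirr : W.HasIrreducibleModPGaloisRep p) (S : Set ℕ) (hS : S.Finite)
    (hcong : ∀ (ℓ : ℕ) [Fact ℓ.Prime], ℓ ∉ S → W.HasGoodReductionAtPrime ℓ →
      G.HasGoodReductionAtPrime ℓ → (p : ℤ) ∣ W.frobeniusTrace ℓ - G.frobeniusTrace ℓ) :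
    ∃ e : W.geomTorsion p ≃+ G.geomTorsion p,
      ∀ (σ : absoluteGaloisGroup ℚ) (P : W.geomTorsion p), e (σ • P) = σ • e P := by
  obtain ⟨e, he⟩ := exists_addEquiv_geomTorsion_of_frobeniusTrace_congr_off_finite W G p hirr S hS hcong
  refine ⟨e.symm, fun σ P ↦ ?_⟩
  apply e.injective
  rw [he, e.apply_symm_apply, e.apply_symm_apply]

end Main

end Literature.NumberTheory.EllipticCurves

end
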